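import Summits.QuantumFields.YangMills.Theorems.ColdStartUniversalityLatticeLangevinMacroscopicMixing
import Summits.QuantumFields.YangMills.Theorems.ColdStartUniversalityUniformColdStartMixingFixedCutoffMixingTimeWindow
import HarnessLib

/-!
# Route `ColdStartUniversality`, aside K_A1 `UniformColdStartMixing` (24809) — MACROSCOPIC OBSERVABLES EQUILIBRATE IN VOLUME-INDEPENDENT
# TIME AT THE CUT-OFFS OF THE STRONG-COUPLING WINDOW `γ ε_K > 6` (pointwise in time, every start, every solution)

Helper file (seat `ym-line-csu-p1`, g28; `--supports stmt-QuantumFields-24809`).  Planner-facing reading of `…LatticeLangevinMacroscopicMixing` in the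
route's cut-off vocabulary (`β'_K = (γε_K)⁻¹/2`, `L_K = (F.P K).sitesPerDir 0`, rate `ρ_K = 1 − 12β'_K = 1 − 6/(γε_K)`, `window_coupling_bounds`):
* ★★★ `coldStart_actionDensity_fixedCutoff_window_volumeFree` / `…_mixingTime_fixedCutoff_window` — at a cut-off `K` with `6 < γε_K`, for every
  solution of the SZZ dynamics at `β'_K` from any deterministic start and every lattice time `u ≥ 0`:
  `|E S_W(U_(2+u))/#𝒫_K − ∫ S_W/#𝒫_K dμ_K| ≤ 27·e^(−ρ_K u)/√ρ_K`, hence `≤ ε` as soon as `u ≥ log(27/(ε√ρ_K))/ρ_K`;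
* ★★★ `coldStart_wilsonLoop_fixedCutoff_window_volumeFree` / `…_mixingTime_fixedCutoff_window` — the same for the spatially averaged `R × T` Wilson
  loop `W̄ = (L_K³)⁻¹ Σ_x W_(R×T)(x; i, j)` with `57(R+T)` in place of `27`;
* ★★★ `coldStart_wilsonLoop_physicalTime_fixedCutoff_window` / `coldStart_actionDensity_physicalTime_fixedCutoff_window` — in the crux's PHYSICAL time
  `s = ε_K t` (`U (s/ε_K)` as in `UniformColdStartMixing`): for every `s ≥ ε_K·(2 + log(57(R+T)/(δ√ρ_K))/ρ_K)` (and `s ≥ 2ε_K`),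
  `|E W̄(U(s/ε_K)) − ∫ W̄ dμ_K| ≤ δ` — POINTWISE in time (not only in Cesàro mean), with a threshold that depends on `K` only through `ε_K` and
  `ρ_K`, NOT through the number of sites `L_K³` (compare g27's `fixedCutoffMixing_explicit_window`: `T_c = O(log L_K)` for loop STRINGS of bounded observables).
PLANNER-FACING, HONEST: (i) only the COARSE cut-offs `γε_K > 6` are covered — for `K → ∞` (`β'_K → ∞`) nothing here applies and nothing K-uniform is
proved; (ii) the observables here are the torus-wide spatial averages of g27's carré bounds, not the crux's unit-block averages `avgObs expMeanLogSU`
(Bałaban's guarded `exp[mean log]` is PIECEWISE — value `1` off the guard — hence not `C³`, and the transport bound does not apply to it as typed);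
(iii) 24809 is ASIDE and NOT restated; no crux, rung or summit statement is proved;
the Yang–Mills mass gap is NOT proved.  THEOREMS ONLY, no definition, no sorry. [cite: ShenZhuZhu2022, §4 Theorem 4.2, Corollary 4.4]
-/

set_option autoImplicit false

noncomputable section

namespace Summit.QuantumFields.YangMills.Theorems.ColdStartUniversality

open MeasureTheory ProbabilityTheory
open scoped NNReal ENNReal BigOperators
open Literature.Probability.Process Literature.MathematicalPhysics.QuantumFieldTheory
open Literature.MathematicalPhysics.QuantumLattice (fundamentalRep fundamentalLatticeRep continuous_fundamentalRep)
open Literature.MathematicalPhysics.QuantumFieldTheory.Balaban1983to89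

/-! ## §1. The action density at a window cut-off -/

/-- ★★★ **Volume-free cold-start equilibration of the action density at a cut-off in the window.**  For `6 < γ ε_K`, every solution of the SZZ
dynamics at `β'_K = (γε_K)⁻¹/2` on `(ℤ/L_K)³` from a deterministic start and every lattice time `u ≥ 0`:
`|E S_W(U_(2+u))/#𝒫_K − ∫ S_W/#𝒫_K dμ_K| ≤ 27·e^(−(1 − 6/(γε_K))u)/√(1 − 6/(γε_K))` — no dependence on `L_K`.
[cite: ShenZhuZhu2022, §4 Theorem 4.2, Corollary 4.4] -/
theorem coldStart_actionDensity_fixedCutoff_window_volumeFree (F : T3ContinuumYM3Torus.T3Family) (γ : ℝ) (K : ℕ) (hK : 6 < γ * (F.P K).eps)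
    (z : (GaugeConfig 3 ((F.P K).sitesPerDir 0) (Matrix.specialUnitaryGroup (Fin 2) ℂ)))
    {Ω : Type} [MeasurableSpace Ω] {P : Measure Ω} [IsProbabilityMeasure P]
    {W : ℝ≥0 → Ω → (Edge 3 ((F.P K).sitesPerDir 0) × NoiseIdx 2 → ℝ)} (hW : IsFlatBrownian W P)
    {U : ℝ≥0 → Ω → (GaugeConfig 3 ((F.P K).sitesPerDir 0) (Matrix.specialUnitaryGroup (Fin 2) ℂ))} (hU0 : ∀ ω, U 0 ω = z)
    (hU : (latticeLangevinDynamics (fundamentalLatticeRep 2) ((γ * (F.P K).eps)⁻¹ / 2)).IsSolution (fundamentalRep (Fin 2)) hW.natFiltration P W U)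
    (u : ℝ≥0) :
    |(∫ ω, wilsonAction (fundamentalRep (Fin 2)) (U ((2 : ℝ≥0) + u) ω) / (Fintype.card (Plaquette 3 ((F.P K).sitesPerDir 0)) : ℝ) ∂P) -
        ∫ V, wilsonAction (fundamentalRep (Fin 2)) V / (Fintype.card (Plaquette 3 ((F.P K).sitesPerDir 0)) : ℝ) ∂(wilsonMeasure (d := 3) (L := ((F.P K).sitesPerDir 0)) (fundamentalRep (Fin 2)) ((γ * (F.P K).eps)⁻¹ / 2))| ≤
      27 * Real.exp (-(1 - 6 / (γ * (F.P K).eps)) * u) / Real.sqrt (1 - 6 / (γ * (F.P K).eps)) := by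
  obtain ⟨hβ, hrate⟩ := window_coupling_bounds F γ K hK
  have h := wilson_coldStart_actionDensity_le_volumeFree ((F.P K).sitesPerDir 0) ((γ * (F.P K).eps)⁻¹ / 2) hβ z hW hU0 hU u
  rw [hrate] at h
  exact h

/-- ★★★ **Volume-independent equilibration time of the action density at a window cut-off**: for `ε > 0` and
`u ≥ log(27/(ε√ρ_K))/ρ_K` (`ρ_K = 1 − 6/(γε_K)`), `|E S_W(U_(2+u))/#𝒫_K − ∫ S_W/#𝒫_K dμ_K| ≤ ε`, for every start and every solution.
[cite: ShenZhuZhu2022, §4 Theorem 4.2, Corollary 4.4] -/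
theorem coldStart_actionDensity_mixingTime_fixedCutoff_window (F : T3ContinuumYM3Torus.T3Family) (γ : ℝ) (K : ℕ) (hK : 6 < γ * (F.P K).eps)
    (z : (GaugeConfig 3 ((F.P K).sitesPerDir 0) (Matrix.specialUnitaryGroup (Fin 2) ℂ)))
    {Ω : Type} [MeasurableSpace Ω] {P : Measure Ω} [IsProbabilityMeasure P]
    {W : ℝ≥0 → Ω → (Edge 3 ((F.P K).sitesPerDir 0) × NoiseIdx 2 → ℝ)} (hW : IsFlatBrownian W P)
    {U : ℝ≥0 → Ω → (GaugeConfig 3 ((F.P K).sitesPerDir 0) (Matrix.specialUnitaryGroup (Fin 2) ℂ))} (hU0 : ∀ ω, U 0 ω = z)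
    (hU : (latticeLangevinDynamics (fundamentalLatticeRep 2) ((γ * (F.P K).eps)⁻¹ / 2)).IsSolution (fundamentalRep (Fin 2)) hW.natFiltration P W U)
    {ε : ℝ} (hε : 0 < ε) (u : ℝ≥0)
    (hu : Real.log (27 / (ε * Real.sqrt (1 - 6 / (γ * (F.P K).eps)))) / (1 - 6 / (γ * (F.P K).eps)) ≤ (u : ℝ)) :
    |(∫ ω, wilsonAction (fundamentalRep (Fin 2)) (U ((2 : ℝ≥0) + u) ω) / (Fintype.card (Plaquette 3 ((F.P K).sitesPerDir 0)) : ℝ) ∂P) -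
        ∫ V, wilsonAction (fundamentalRep (Fin 2)) V / (Fintype.card (Plaquette 3 ((F.P K).sitesPerDir 0)) : ℝ) ∂(wilsonMeasure (d := 3) (L := ((F.P K).sitesPerDir 0)) (fundamentalRep (Fin 2)) ((γ * (F.P K).eps)⁻¹ / 2))| ≤ ε := by
  obtain ⟨hβ, hrate⟩ := window_coupling_bounds F γ K hK
  rw [← hrate] at hu
  exact wilson_coldStart_actionDensity_mixingTime_volumeFree ((F.P K).sitesPerDir 0) ((γ * (F.P K).eps)⁻¹ / 2) hβ z hW hU0 hU hε u hu

/-! ## §2. Spatially averaged Wilson loops at a window cut-off -/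

/-- ★★★ **Volume-free cold-start equilibration of spatially averaged Wilson loops at a cut-off in the window.**  For `6 < γ ε_K`, `R + T > 0`,
every solution at `β'_K` from a deterministic start and every lattice time `u ≥ 0`, with `W̄ = (#sites)⁻¹ Σ_x W_(R×T)(x; i, j)`:
`|E W̄(U_(2+u)) − ∫ W̄ dμ_K| ≤ 57(R+T)·e^(−(1 − 6/(γε_K))u)/√(1 − 6/(γε_K))`. [cite: ShenZhuZhu2022, §4 Theorem 4.2, Corollary 4.4] -/
theorem coldStart_wilsonLoop_fixedCutoff_window_volumeFree (F : T3ContinuumYM3Torus.T3Family) (γ : ℝ) (K : ℕ) (hK : 6 < γ * (F.P K).eps)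
    (i j : Fin 3) (R T : ℕ) (hRT : 0 < R + T)
    (z : (GaugeConfig 3 ((F.P K).sitesPerDir 0) (Matrix.specialUnitaryGroup (Fin 2) ℂ)))
    {Ω : Type} [MeasurableSpace Ω] {P : Measure Ω} [IsProbabilityMeasure P]
    {W : ℝ≥0 → Ω → (Edge 3 ((F.P K).sitesPerDir 0) × NoiseIdx 2 → ℝ)} (hW : IsFlatBrownian W P)
    {U : ℝ≥0 → Ω → (GaugeConfig 3 ((F.P K).sitesPerDir 0) (Matrix.specialUnitaryGroup (Fin 2) ℂ))} (hU0 : ∀ ω, U 0 ω = z)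
    (hU : (latticeLangevinDynamics (fundamentalLatticeRep 2) ((γ * (F.P K).eps)⁻¹ / 2)).IsSolution (fundamentalRep (Fin 2)) hW.natFiltration P W U)
    (u : ℝ≥0) :
    |(∫ ω, (((Fintype.card (Site 3 ((F.P K).sitesPerDir 0)) : ℝ))⁻¹ * ∑ x : Site 3 ((F.P K).sitesPerDir 0), wilsonLoop (fundamentalRep (Fin 2)) x i j R T (U ((2 : ℝ≥0) + u) ω)) ∂P) -
        ∫ V, (((Fintype.card (Site 3 ((F.P K).sitesPerDir 0)) : ℝ))⁻¹ * ∑ x : Site 3 ((F.P K).sitesPerDir 0), wilsonLoop (fundamentalRep (Fin 2)) x i j R T V) ∂(wilsonMeasure (d := 3) (L := ((F.P K).sitesPerDir 0)) (fundamentalRep (Fin 2)) ((γ * (F.P K).eps)⁻¹ / 2))| ≤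
      57 * ((R : ℝ) + T) * Real.exp (-(1 - 6 / (γ * (F.P K).eps)) * u) / Real.sqrt (1 - 6 / (γ * (F.P K).eps)) := by
  obtain ⟨hβ, hrate⟩ := window_coupling_bounds F γ K hK
  have h := wilson_coldStart_loopAverage_le_volumeFree ((F.P K).sitesPerDir 0) ((γ * (F.P K).eps)⁻¹ / 2) hβ i j R T hRT z hW hU0 hU u
  rw [hrate] at h
  exact h

/-- ★★★ **Volume-independent equilibration time of spatially averaged Wilson loops at a window cut-off**: for `ε > 0`, `R + T > 0` and
`u ≥ log(57(R+T)/(ε√ρ_K))/ρ_K` (`ρ_K = 1 − 6/(γε_K)`), `|E W̄(U_(2+u)) − ∫ W̄ dμ_K| ≤ ε`, for every start and every solution.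
[cite: ShenZhuZhu2022, §4 Theorem 4.2, Corollary 4.4] -/
theorem coldStart_wilsonLoop_mixingTime_fixedCutoff_window (F : T3ContinuumYM3Torus.T3Family) (γ : ℝ) (K : ℕ) (hK : 6 < γ * (F.P K).eps)
    (i j : Fin 3) (R T : ℕ) (hRT : 0 < R + T)
    (z : (GaugeConfig 3 ((F.P K).sitesPerDir 0) (Matrix.specialUnitaryGroup (Fin 2) ℂ)))
    {Ω : Type} [MeasurableSpace Ω] {P : Measure Ω} [IsProbabilityMeasure P]
    {W : ℝ≥0 → Ω → (Edge 3 ((F.P K).sitesPerDir 0) × NoiseIdx 2 → ℝ)} (hW : IsFlatBrownian W P)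
    {U : ℝ≥0 → Ω → (GaugeConfig 3 ((F.P K).sitesPerDir 0) (Matrix.specialUnitaryGroup (Fin 2) ℂ))} (hU0 : ∀ ω, U 0 ω = z)
    (hU : (latticeLangevinDynamics (fundamentalLatticeRep 2) ((γ * (F.P K).eps)⁻¹ / 2)).IsSolution (fundamentalRep (Fin 2)) hW.natFiltration P W U)
    {ε : ℝ} (hε : 0 < ε) (u : ℝ≥0)
    (hu : Real.log (57 * ((R : ℝ) + T) / (ε * Real.sqrt (1 - 6 / (γ * (F.P K).eps)))) / (1 - 6 / (γ * (F.P K).eps)) ≤ (u : ℝ)) :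
    |(∫ ω, (((Fintype.card (Site 3 ((F.P K).sitesPerDir 0)) : ℝ))⁻¹ * ∑ x : Site 3 ((F.P K).sitesPerDir 0), wilsonLoop (fundamentalRep (Fin 2)) x i j R T (U ((2 : ℝ≥0) + u) ω)) ∂P) -
        ∫ V, (((Fintype.card (Site 3 ((F.P K).sitesPerDir 0)) : ℝ))⁻¹ * ∑ x : Site 3 ((F.P K).sitesPerDir 0), wilsonLoop (fundamentalRep (Fin 2)) x i j R T V) ∂(wilsonMeasure (d := 3) (L := ((F.P K).sitesPerDir 0)) (fundamentalRep (Fin 2)) ((γ * (F.P K).eps)⁻¹ / 2))| ≤ ε := by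
  obtain ⟨hβ, hrate⟩ := window_coupling_bounds F γ K hK
  rw [← hrate] at hu
  exact wilson_coldStart_loopAverage_mixingTime_volumeFree ((F.P K).sitesPerDir 0) ((γ * (F.P K).eps)⁻¹ / 2) hβ i j R T hRT z hW hU0 hU hε u hu

/-! ## §3. The same in the crux's physical time `s = ε_K t` -/

/-- Time bookkeeping: if `2ε ≤ s` (`ε > 0`) then `(s/ε).toNNReal = 2 + u` with `u = (s/ε − 2).toNNReal` and `(u : ℝ) = s/ε − 2`. [folklore] -/
theorem toNNReal_div_eq_two_add {s e : ℝ} (he : 0 < e) (h2 : 2 * e ≤ s) :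
    (s / e).toNNReal = (2 : ℝ≥0) + (s / e - 2).toNNReal ∧ (((s / e - 2).toNNReal : ℝ≥0) : ℝ) = s / e - 2 := by
  have ht2 : 2 ≤ s / e := by rw [le_div_iff₀ he]; linarith
  have hu : (((s / e - 2).toNNReal : ℝ≥0) : ℝ) = s / e - 2 := Real.coe_toNNReal _ (by linarith)
  refine ⟨?_, hu⟩
  apply NNReal.eq
  rw [Real.coe_toNNReal _ (by linarith), NNReal.coe_add, hu]
  norm_num

/-- ★★★ **Pointwise-in-physical-time equilibration of spatially averaged Wilson loops at a window cut-off, volume-independent threshold.**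
For `6 < γ ε_K`, `R + T > 0`, `δ > 0`: for every physical time `s` with `2ε_K ≤ s` and `ε_K·(2 + log(57(R+T)/(δ√ρ_K))/ρ_K) ≤ s`
(`ρ_K = 1 − 6/(γε_K)`), every solution of the SZZ dynamics at `β'_K` from a deterministic start satisfies
`|E W̄(U(s/ε_K)) − ∫ W̄ dμ_K| ≤ δ` (`U (s/ε_K).toNNReal` as in the crux).  The threshold does not involve `L_K`.
[cite: ShenZhuZhu2022, §4 Theorem 4.2, Corollary 4.4] -/
theorem coldStart_wilsonLoop_physicalTime_fixedCutoff_window (F : T3ContinuumYM3Torus.T3Family) (γ : ℝ) (K : ℕ) (hK : 6 < γ * (F.P K).eps)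
    (i j : Fin 3) (R T : ℕ) (hRT : 0 < R + T)
    (z : (GaugeConfig 3 ((F.P K).sitesPerDir 0) (Matrix.specialUnitaryGroup (Fin 2) ℂ)))
    {Ω : Type} [MeasurableSpace Ω] {P : Measure Ω} [IsProbabilityMeasure P]
    {W : ℝ≥0 → Ω → (Edge 3 ((F.P K).sitesPerDir 0) × NoiseIdx 2 → ℝ)} (hW : IsFlatBrownian W P)
    {U : ℝ≥0 → Ω → (GaugeConfig 3 ((F.P K).sitesPerDir 0) (Matrix.specialUnitaryGroup (Fin 2) ℂ))} (hU0 : ∀ ω, U 0 ω = z)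
    (hU : (latticeLangevinDynamics (fundamentalLatticeRep 2) ((γ * (F.P K).eps)⁻¹ / 2)).IsSolution (fundamentalRep (Fin 2)) hW.natFiltration P W U)
    {δ : ℝ} (hδ : 0 < δ) (s : ℝ) (h2 : 2 * (F.P K).eps ≤ s)
    (hs : (F.P K).eps * (2 + Real.log (57 * ((R : ℝ) + T) / (δ * Real.sqrt (1 - 6 / (γ * (F.P K).eps)))) / (1 - 6 / (γ * (F.P K).eps))) ≤ s) :
    |(∫ ω, (((Fintype.card (Site 3 ((F.P K).sitesPerDir 0)) : ℝ))⁻¹ * ∑ x : Site 3 ((F.P K).sitesPerDir 0), wilsonLoop (fundamentalRep (Fin 2)) x i j R T (U (s / (F.P K).eps).toNNReal ω)) ∂P) -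
        ∫ V, (((Fintype.card (Site 3 ((F.P K).sitesPerDir 0)) : ℝ))⁻¹ * ∑ x : Site 3 ((F.P K).sitesPerDir 0), wilsonLoop (fundamentalRep (Fin 2)) x i j R T V) ∂(wilsonMeasure (d := 3) (L := ((F.P K).sitesPerDir 0)) (fundamentalRep (Fin 2)) ((γ * (F.P K).eps)⁻¹ / 2))| ≤ δ := by
  have he : 0 < (F.P K).eps := (F.P K).eps_pos
  obtain ⟨hsplit, hu⟩ := toNNReal_div_eq_two_add he h2
  rw [hsplit]
  refine coldStart_wilsonLoop_mixingTime_fixedCutoff_window F γ K hK i j R T hRT z hW hU0 hU hδ _ ?_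
  rw [hu, le_sub_iff_add_le, le_div_iff₀ he]
  linarith

/-- ★★★ **Pointwise-in-physical-time equilibration of the action density at a window cut-off, volume-independent threshold.**  For `6 < γ ε_K`,
`δ > 0`: for every physical time `s` with `2ε_K ≤ s` and `ε_K·(2 + log(27/(δ√ρ_K))/ρ_K) ≤ s`, every solution at `β'_K` from a deterministic start,
`|E S_W(U(s/ε_K))/#𝒫_K − ∫ S_W/#𝒫_K dμ_K| ≤ δ`. [cite: ShenZhuZhu2022, §4 Theorem 4.2, Corollary 4.4] -/
theorem coldStart_actionDensity_physicalTime_fixedCutoff_window (F : T3ContinuumYM3Torus.T3Family) (γ : ℝ) (K : ℕ) (hK : 6 < γ * (F.P K).eps)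
    (z : (GaugeConfig 3 ((F.P K).sitesPerDir 0) (Matrix.specialUnitaryGroup (Fin 2) ℂ)))
    {Ω : Type} [MeasurableSpace Ω] {P : Measure Ω} [IsProbabilityMeasure P]
    {W : ℝ≥0 → Ω → (Edge 3 ((F.P K).sitesPerDir 0) × NoiseIdx 2 → ℝ)} (hW : IsFlatBrownian W P)
    {U : ℝ≥0 → Ω → (GaugeConfig 3 ((F.P K).sitesPerDir 0) (Matrix.specialUnitaryGroup (Fin 2) ℂ))} (hU0 : ∀ ω, U 0 ω = z)
    (hU : (latticeLangevinDynamics (fundamentalLatticeRep 2) ((γ * (F.P K).eps)⁻¹ / 2)).IsSolution (fundamentalRep (Fin 2)) hW.natFiltration P W U)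
    {δ : ℝ} (hδ : 0 < δ) (s : ℝ) (h2 : 2 * (F.P K).eps ≤ s)
    (hs : (F.P K).eps * (2 + Real.log (27 / (δ * Real.sqrt (1 - 6 / (γ * (F.P K).eps)))) / (1 - 6 / (γ * (F.P K).eps))) ≤ s) :
    |(∫ ω, wilsonAction (fundamentalRep (Fin 2)) (U (s / (F.P K).eps).toNNReal ω) / (Fintype.card (Plaquette 3 ((F.P K).sitesPerDir 0)) : ℝ) ∂P) -
        ∫ V, wilsonAction (fundamentalRep (Fin 2)) V / (Fintype.card (Plaquette 3 ((F.P K).sitesPerDir 0)) : ℝ) ∂(wilsonMeasure (d := 3) (L := ((F.P K).sitesPerDir 0)) (fundamentalRep (Fin 2)) ((γ * (F.P K).eps)⁻¹ / 2))| ≤ δ := by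
  have he : 0 < (F.P K).eps := (F.P K).eps_pos
  obtain ⟨hsplit, hu⟩ := toNNReal_div_eq_two_add he h2
  rw [hsplit]
  refine coldStart_actionDensity_mixingTime_fixedCutoff_window F γ K hK z hW hU0 hU hδ _ ?_
  rw [hu, le_sub_iff_add_le, le_div_iff₀ he]
  linarith

end Summit.QuantumFields.YangMills.Theorems.ColdStartUniversality
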